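import Summits.QuantumFields.BalabanUV.Beta.CovariantBoxPoincare

/-!
# Beta / CovariantBoxPoincareGauge — THE |A|-HALF ROUTE: the covariant block Poincaré inequality from a (3.35)-LITERAL GAUGE
# HYPOTHESIS ALONE, j-uniformly.  Part (B) (`CovariantBoxPoincare`) allows ANY orthogonal transports in the Poincaré step; taking the
# small gauge `g` of [B9] (3.35) itself (gauged in-block bond variables `ε`-close to `1`, `ε = O(1)Mα₀/n` — the |A|-half) and
# paying the mismatch between the `g`-mean and the operator's contour-transport mean `Σ T(x)f(x)` by ONE gauge-comparison datum
# `‖g(x)T(x)ᵀ − O‖ ≤ δ` (a single orthogonal `O` per block; for contour transports `δ ≤ ν(n−1)ε = O(1)νMα₀` by path products):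
# `(1 − 4Pνε² − 4δ²)·Σ|f|² ≤ (4P/c²)·Σ|∇_U f|² + (4/n^ν)·|Σ T f|²`, loss `≤ 8ν²(O(1)Mα₀)²` — UNIFORM in the block side, small iff
# `O(1)Mα₀` is small (print's standing assumption p. 396) (unit `b2b-balaban-beta-d4-p2`, GEN 7, MODEL crew; claim
# «MULTISCALE-POINCARE-MODEL» journal l.16779, part (E); answers the scope note INFO-3 of d4-p3-g8's XREAD C-d4p3-26 l.17507)

HONEST FRAMING: discharging `BetaPertH` makes Bałaban's UV stability UNCONDITIONAL — NOT the continuum limit, NOT the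
Clay problem.  HONEST DEPENDENCY (verbatim): «continuum YM on T⁴ ⇐ BetaPertH ∧ nine spine estimates (0/9 proved);
BetaPertH ⇐ (D1) ∧ (D4) ∧ CAP+tail; G-an2-4 gates asym, D1 and NE2/3/4.»  THIS MODULE DISCHARGES NOTHING of `BetaPertH`,
asserts NOTHING printed and cites nothing as a fact (ABSOLUTE RULE): [folklore] lattice calculus about the pv21 component MODEL
(`B9Thm37Glue.covD`); the chart, bonds, operator transports `T`, gauge `g`, comparison rotation `O` and the sizes `ε`, `δ` are
DATA.  WHY (row D4, O.2 item (v)): for the tree-transport route the thin-loop defect from a (3.35)-shape gauge is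
`(2ν(n−1)+1)ε = O(Mα₀)`, NOT thin, so part (B)'s loss `4Pνh²` grows like `n²` (d4-p3 XREAD C-d4p3-26 INFO-3, this lineage's
`CovariantPlateauBlocksPairGauge` v1.0.1); the j-uniform entrance from (3.35) through tree transports needs both halves
(d4-p3 `hplaqW_of_gauge335` ⟹ gen-6 `hdef_le_of_plaqW`).  THIS FILE shows that for the POINCARÉ step — unlike the bump
estimate E-I3 — the |A|-half suffices: each bond's defect enters squared against `P ≍ n²`, `P·ε² ≍ (nε)² = O(Mα₀)²`.
SHAPES located at [B9] = `Balaban1985BackgroundPropagators` (3.19) p. 393, (3.24) p. 394, (3.35) p. 396 («there exists a gauge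
transformation u on □ such that Uᵘ = e^{iηA} … |A| < O(1)Mα₀(L^jη)^{−1}»).  No class change on row D4 (critical-path width 0; D4
DISCHARGE NO DATE); NOT BetaPertH, NOT continuum, NOT Clay, NOT summit progress.

CONTENT (kernel, 0 sorry).  §1 re-expansion of the gauged mean through the operator transports (`tf_gauge_eq`); §2 the
comparison estimate `sum_sq_gauge_mean_le` (`|Σ g f|² ≤ 2|Σ T f|² + 2δ²·n^ν·Σ|f|²`); §3 END **`covariant_box_poincare_gauge`**.
-/

namespace Summit.QuantumFields.BalabanUV.Beta.CovariantBoxPoincareGauge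

open Finset Function
open Summit.QuantumFields.BalabanUV.Beta.BoxPoincare
open Summit.QuantumFields.BalabanUV.Beta.CovariantBoxPoincare
open Literature.MathematicalPhysics.QuantumFieldTheory.Balaban1983to89.B9Thm37Glue (covD covD_apply)
open Literature.MathematicalPhysics.QuantumFieldTheory.Balaban1983to89.B9Thm37GlueTorusCovLevelsPoinc (sum_sq_orth_apply)

noncomputable section

variable {St Bd Cp : Type} [Fintype Cp] [DecidableEq Cp] {ν n : ℕ}

/-! ## §1 The gauged mean through the operator transports -/

section Reexpansion

variable (φ : Box ν n → St) (T g : Box ν n → Cp → Cp → ℝ) (O : Cp → Cp → ℝ)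

/-- The gauge-comparison matrix `D(v) = g(v)·T(v)ᵀ − O` in components: `D(v)_{aj} = Σ_k g(v)_{ak} T(v)_{jk} − O_{aj}`.
[folklore] -/
def cmpD (v : Box ν n) (a j : Cp) : ℝ := ∑ k, g v a k * T v j k - O a j

/-- **Re-expansion**: `(g(v)f(φ v))_a = Σ_j (O_{aj} + D(v)_{aj})·(T(v)f(φ v))_j` — the gauged field is the rotated-plus-defect
image of the operator-transported field (orthonormality of `T(v)`). [folklore] -/
theorem tf_gauge_eq (hT : ∀ v i i', ∑ k, T v k i * T v k i' = if i = i' then (1 : ℝ) else 0) (f : St × Cp → ℝ)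
    (v : Box ν n) (a : Cp) :
    tf g φ f v a = ∑ j, (O a j + cmpD T g O v a j) * tf T φ f v j := by
  unfold tf
  calc ∑ k, g v a k * f (φ v, k) = ∑ k, g v a k * ∑ j, T v j k * ∑ m, T v j m * f (φ v, m) := by
        refine Finset.sum_congr rfl fun k _ => ?_
        rw [orth_cancel (hT v) (fun m => f (φ v, m)) k]
    _ = ∑ k, ∑ j, g v a k * (T v j k * ∑ m, T v j m * f (φ v, m)) := by
        refine Finset.sum_congr rfl fun k _ => ?_
        rw [Finset.mul_sum]
    _ = ∑ j, ∑ k, g v a k * (T v j k * ∑ m, T v j m * f (φ v, m)) := Finset.sum_comm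
    _ = ∑ j, (∑ k, g v a k * T v j k) * ∑ m, T v j m * f (φ v, m) := by
        refine Finset.sum_congr rfl fun j _ => ?_
        rw [Finset.sum_mul]
        exact Finset.sum_congr rfl fun k _ => by ring
    _ = ∑ j, (O a j + cmpD T g O v a j) * ∑ m, T v j m * f (φ v, m) := by
        refine Finset.sum_congr rfl fun j _ => ?_
        rw [cmpD]
        ring

end Reexpansion

/-! ## §2 The comparison estimate -/

section Comparison

variable (φ : Box ν n → St) (T g : Box ν n → Cp → Cp → ℝ) (O : Cp → Cp → ℝ)

/-- **`|Σ_v g f|² ≤ 2|Σ_v T f|² + 2δ²·n^ν·Σ|f|²`**: split the gauged mean into the `O`-rotated operator mean (isometry of `O`) and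
the defect part (`‖D(v)u‖ ≤ δ‖u‖`, Cauchy–Schwarz over the `n^ν` sites, isometry of `T(v)`). [folklore] -/
theorem sum_sq_gauge_mean_le (hT : ∀ v i i', ∑ k, T v k i * T v k i' = if i = i' then (1 : ℝ) else 0)
    (hO : ∀ i i', ∑ k, O k i * O k i' = if i = i' then (1 : ℝ) else 0) {δ : ℝ}
    (hcmp : ∀ v (u : Cp → ℝ), ∑ a, (∑ j, cmpD T g O v a j * u j) ^ 2 ≤ δ ^ 2 * ∑ j, u j ^ 2) (f : St × Cp → ℝ) :
    ∑ a, (∑ v : Box ν n, tf g φ f v a) ^ 2 ≤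
      2 * ∑ a, (∑ v : Box ν n, tf T φ f v a) ^ 2 + 2 * δ ^ 2 * (n : ℝ) ^ ν * ∑ v : Box ν n, ∑ k, f (φ v, k) ^ 2 := by
  set X : Cp → ℝ := fun a => ∑ j, O a j * ∑ v : Box ν n, tf T φ f v j with hX
  set Y : Cp → ℝ := fun a => ∑ v : Box ν n, ∑ j, cmpD T g O v a j * tf T φ f v j with hY
  have hsplit : ∀ a, ∑ v : Box ν n, tf g φ f v a = X a + Y a := by
    intro a
    have h1 : X a = ∑ v : Box ν n, ∑ j, O a j * tf T φ f v j := by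
      simp only [hX, Finset.mul_sum]
      exact Finset.sum_comm
    have h2 : Y a = ∑ v : Box ν n, ∑ j, cmpD T g O v a j * tf T φ f v j := by rw [hY]
    rw [h1, h2, ← Finset.sum_add_distrib]
    refine Finset.sum_congr rfl fun v _ => ?_
    rw [tf_gauge_eq φ T g O hT f v a, ← Finset.sum_add_distrib]
    exact Finset.sum_congr rfl fun j _ => by ring
  -- the rotated part: isometry of O
  have hXsq : ∑ a, X a ^ 2 = ∑ a, (∑ v : Box ν n, tf T φ f v a) ^ 2 := by
    rw [hX]
    exact sum_sq_orth_apply hO (fun j => ∑ v : Box ν n, tf T φ f v j)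
  -- the defect part: Cauchy–Schwarz over the sites, the defect bound, isometry of T(v)
  have hcard : ((Finset.univ : Finset (Box ν n)).card : ℝ) = (n : ℝ) ^ ν := by
    rw [Finset.card_univ, card_box]; push_cast; ring
  have hYsq : ∑ a, Y a ^ 2 ≤ δ ^ 2 * (n : ℝ) ^ ν * ∑ v : Box ν n, ∑ k, f (φ v, k) ^ 2 := by
    calc ∑ a, Y a ^ 2 ≤ ∑ a, (n : ℝ) ^ ν * ∑ v : Box ν n, (∑ j, cmpD T g O v a j * tf T φ f v j) ^ 2 := by
          refine Finset.sum_le_sum fun a _ => ?_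
          rw [hY]
          have h := sq_sum_le_card_mul_sum_sq (s := (Finset.univ : Finset (Box ν n)))
            (f := fun v => ∑ j, cmpD T g O v a j * tf T φ f v j)
          rwa [hcard] at h
      _ = (n : ℝ) ^ ν * ∑ v : Box ν n, ∑ a, (∑ j, cmpD T g O v a j * tf T φ f v j) ^ 2 := by
          rw [← Finset.mul_sum, Finset.sum_comm]
      _ ≤ (n : ℝ) ^ ν * ∑ v : Box ν n, δ ^ 2 * ∑ k, f (φ v, k) ^ 2 := by
          refine mul_le_mul_of_nonneg_left (Finset.sum_le_sum fun v _ => ?_) (by positivity)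
          refine (hcmp v (tf T φ f v)).trans (le_of_eq ?_)
          congr 1
          exact sum_sq_orth_apply (hT v) (fun k => f (φ v, k))
      _ = δ ^ 2 * (n : ℝ) ^ ν * ∑ v : Box ν n, ∑ k, f (φ v, k) ^ 2 := by rw [← Finset.mul_sum]; ring
  calc ∑ a, (∑ v : Box ν n, tf g φ f v a) ^ 2 = ∑ a, (X a + Y a) ^ 2 := Finset.sum_congr rfl fun a _ => by rw [hsplit]
    _ ≤ ∑ a, (2 * X a ^ 2 + 2 * Y a ^ 2) := Finset.sum_le_sum fun a _ => by nlinarith [sq_nonneg (X a - Y a)]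
    _ = 2 * ∑ a, X a ^ 2 + 2 * ∑ a, Y a ^ 2 := by rw [Finset.sum_add_distrib, Finset.mul_sum, Finset.mul_sum]
    _ ≤ 2 * ∑ a, (∑ v : Box ν n, tf T φ f v a) ^ 2 + 2 * δ ^ 2 * (n : ℝ) ^ ν * ∑ v : Box ν n, ∑ k, f (φ v, k) ^ 2 := by
        rw [hXsq]; nlinarith

end Comparison

/-! ## §3 The END: the |A|-half route -/

section Main

variable {src tgt : Bd → St}

/-- **THE COVARIANT BLOCK POINCARÉ INEQUALITY FROM THE (3.35)-LITERAL GAUGE HYPOTHESIS ALONE (MODEL).**  Data: box chart `φ`,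
in-box bonds `e` (`src = φ v`, `tgt = φ(v+e_i)`, `|c| ≥ c_min`), ANY bond matrices `Rm`, the operator's orthogonal transports
`T`, an orthogonal GAUGE `g` on the block whose gauged in-block bond variables `g(x)Rm(b)g(y)ᵀ` are `ε`-close to `1` (quadratic-form
shape — the |A|-half of (3.35)), and ONE orthogonal `O` with `‖g(x)T(x)ᵀ − O‖ ≤ δ` on the block (gauge comparison).  Then with
`P = νn(n−1)`: **`(1 − 4Pνε² − 4δ²)·Σ_v|f(φ v)|² ≤ (4P/c_min²)·Σ_{in-box}|(∇_U f)(e)|² + (4/n^ν)·Σ_a(Σ_v(T f)(φ v)_a)²`** — with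
`ε = C/n`, `δ = νC` the loss is `≤ 8ν²C²`, uniform in `n`. [cite: Balaban1985BackgroundPropagators, (3.24) p.394 + (3.35) p.396] -/
theorem covariant_box_poincare_gauge (φ : Box ν n → St)
    (e : (v : Box ν n) → (i : Fin ν) → ((v i : ℕ) + 1 < n) → Bd)
    (hsrc : ∀ v i hv, src (e v i hv) = φ v) (htgt : ∀ v i hv, tgt (e v i hv) = φ (succ v i hv))
    (c : Bd → ℝ) {cmin : ℝ} (hcmin : 0 < cmin) (hcb : ∀ v i hv, cmin ≤ |c (e v i hv)|)
    (Rm : Bd → Cp → Cp → ℝ) (T g : Box ν n → Cp → Cp → ℝ) (O : Cp → Cp → ℝ)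
    (hT : ∀ v i i', ∑ k, T v k i * T v k i' = if i = i' then (1 : ℝ) else 0)
    (hg : ∀ v i i', ∑ k, g v k i * g v k i' = if i = i' then (1 : ℝ) else 0)
    (hO : ∀ i i', ∑ k, O k i * O k i' = if i = i' then (1 : ℝ) else 0) {ε δ : ℝ}
    (hgauge : ∀ v i hv (u : Cp → ℝ),
      ∑ a, (∑ j, (hol Rm g e v i hv a j - if a = j then 1 else 0) * u j) ^ 2 ≤ ε ^ 2 * ∑ j, u j ^ 2)
    (hcmp : ∀ v (u : Cp → ℝ), ∑ a, (∑ j, cmpD T g O v a j * u j) ^ 2 ≤ δ ^ 2 * ∑ j, u j ^ 2)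
    (f : St × Cp → ℝ) :
    (1 - 4 * ((ν : ℝ) * n * ((n : ℝ) - 1)) * ν * ε ^ 2 - 4 * δ ^ 2) * ∑ v : Box ν n, ∑ k, f (φ v, k) ^ 2 ≤
      4 * ((ν : ℝ) * n * ((n : ℝ) - 1)) / cmin ^ 2 *
          ∑ v : Box ν n, ∑ i : Fin ν,
            (if hv : (v i : ℕ) + 1 < n then ∑ k, covD src tgt c Rm f (e v i hv, k) ^ 2 else 0) +
        4 / (n : ℝ) ^ ν * ∑ a, (∑ v : Box ν n, tf T φ f v a) ^ 2 := by
  -- part (B) with the gauge as transports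
  have hB := covariant_box_poincare φ e hsrc htgt c hcmin hcb Rm g hg hgauge f
  -- the comparison of the two means
  have hM := sum_sq_gauge_mean_le φ T g O hT hO hcmp f
  set Sf : ℝ := ∑ v : Box ν n, ∑ k, f (φ v, k) ^ 2
  set MT : ℝ := ∑ a, (∑ v : Box ν n, tf T φ f v a) ^ 2
  set Mg : ℝ := ∑ a, (∑ v : Box ν n, tf g φ f v a) ^ 2
  have hN : 0 ≤ (n : ℝ) ^ ν := by positivity
  -- (2/N)·Mg ≤ (4/N)·MT + 4δ²·Sf  (also when N = 0, where 2/N = 0)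
  have hkey : 2 / (n : ℝ) ^ ν * Mg ≤ 4 / (n : ℝ) ^ ν * MT + 4 * δ ^ 2 * Sf := by
    rcases eq_or_lt_of_le hN with h0 | hpos
    · rw [← h0]; simp; positivity
    · have h1 : 2 / (n : ℝ) ^ ν * Mg ≤ 2 / (n : ℝ) ^ ν * (2 * MT + 2 * δ ^ 2 * (n : ℝ) ^ ν * Sf) :=
        mul_le_mul_of_nonneg_left hM (by positivity)
      refine h1.trans (le_of_eq ?_)
      field_simp
      ring
  have hrew : (1 - 4 * ((ν : ℝ) * n * ((n : ℝ) - 1)) * ν * ε ^ 2 - 4 * δ ^ 2) * Sf =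
      (1 - 4 * ((ν : ℝ) * n * ((n : ℝ) - 1)) * ν * ε ^ 2) * Sf - 4 * δ ^ 2 * Sf := by ring
  rw [hrew]
  linarith

end Main

end

end Summit.QuantumFields.BalabanUV.Beta.CovariantBoxPoincareGauge
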